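import Mathlib
import Literature.NumberTheory.Automorphic.FuchsianEisensteinTails
import Literature.NumberTheory.Automorphic.FuchsianEisensteinHolomorphy

/-!
# The truncated Eisenstein series as a holomorphic `L²(F)`-valued function of `s` (`Re s > 1`)
(Iwaniec, *Spectral Methods of Automorphic Forms*, GSM 53, §6.2 (6.15) & §6.4 (6.29), (3.20); PDF pp. 46, 85, 88)

Nineteenth brick of the general-`Γ` Eisenstein series, third file of **Chapter 6 (meromorphic
continuation of `E_𝔞(z, s)`)** for a general finite volume group (towards `Iwaniec2002_eq_12_5` /
`Iwaniec2002_thm_12_1` through `Fuchsian.SpectralParts`). The continuation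
(`FuchsianEisensteinContinuation`) produces a MEROMORPHIC `L²(F)`-valued function of `s` and
identifies it with `s ↦ [E^Y_𝔞ᵢ(·, s)]` on `Re s > 1` by the identity theorem; for this the latter
must itself be known to be holomorphic there, which is proved here. Everything is PROVED; no fact is
introduced.

1. (§1) **locally uniform bounds**: for a compact set `S ⊆ {Re s > 1}` of parameters and `Y ≥ 1`,
   `|E^Y_𝔞ᵢ(z, s)| ≤ B` for all `z ∈ ℍ`, `s ∈ S` (`exists_norm_eisTrunc_le_uniform`: the compact core
   with the joint continuity of `(z, s) ↦ E_𝔞ᵢ(z, s)`, and the explicit frame estimates (3.20) with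
   `c(Re s)` and `|φᵢⱼ(s)|` bounded on `S`).
2. (§2) `s ↦ E^Y_𝔞ᵢ(z, s)` is holomorphic on `Re s > 1` pointwise (`differentiableOn_eisTrunc_apply`,
   via `E^Y = E - θᵢ^s - Σⱼ φᵢⱼ(s) θⱼ^{1-s}`); the class `eisTruncLp Γ F σ i s Y = [E^Y_𝔞ᵢ(·, s)]`; and
   **`s ↦ [E^Y_𝔞ᵢ(·, s)] ∈ L²(F)` is holomorphic on `Re s > 1`** (`analyticOnNhd_eisTruncLp`, by
   `Literature.Analysis.Complex.analyticOnNhd_of_locally_bounded`).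

## References
* [Iwaniec2002] H. Iwaniec, *Spectral Methods of Automorphic Forms*, 2nd ed., GSM 53, AMS 2002,
  §6.2 (6.15), PDF p. 85; §6.4 (6.29), PDF p. 88; (3.20), PDF p. 46
  (held copy `book:iwaniec2002-spectral-methods-automorphic-forms`).

Literature: `eisTrunc`, `eisTrunc_frame`, `eisTrunc_of_invHeight_le`, `memLp_eisTrunc`, `measurable_eisTrunc`,
`isAutomorphic_eisTrunc` (`FuchsianEisensteinTruncation`); `eisGrowthConst`, `two_mul_two_rpow_neg_lt_one`,
`norm_eisCusp_frame_sub_cpow_le`, `norm_eisCusp_frame_le_of_ne` (`FuchsianEisensteinGrowth`); `continuousOn_eisCusp₂`,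
`differentiableOn_eisCusp`, `differentiableOn_eisScattering`, `continuousOn_eisScattering` (`FuchsianEisensteinHolomorphy`);
`tailEis`, `differentiable_tailEis_apply`, `eisCusp_eq_eisTrunc_add_tails` (`FuchsianEisensteinTails`);
`exists_compact_of_invHeight_le`, `exists_smul_mem_cuspStrip_of_lt` (`FuchsianInvariantHeight`);
`analyticOnNhd_of_locally_bounded` (`Analysis/Complex/SquareIntegrableHolomorphicFamily`).
-/

noncomputable section

namespace Literature.NumberTheory.Automorphic

namespace Fuchsian

open _root_.MeasureTheory _root_.Set _root_.Filter _root_.Real _root_.Topology _root_.Metric _root_.UpperHalfPlane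
open scoped _root_.ENNReal _root_.NNReal _root_.MatrixGroups _root_.Pointwise

variable {Γ : Subgroup (GL (Fin 2) ℝ)} {F : Set ℍ} {h : ℕ} {𝔞 : Fin h → OnePoint ℝ} {σ : Fin h → SL(2, ℝ)}

/-! ## 1. Locally uniform bounds for the truncated Eisenstein series in `s` -/

section UniformBound

variable (hΓ : Γ ≤ (Matrix.SpecialLinearGroup.toGL : SL(2, ℝ) →* GL (Fin 2) ℝ).range)
  (hneg : (-1 : GL (Fin 2) ℝ) ∈ Γ) (hd : IsDiscreteSubgroup Γ) (hF : IsHypFundamentalDomain Γ F)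
  (hvol : volume F < ⊤)
  (hinfty : ∀ i, (Matrix.SpecialLinearGroup.toGL (σ i) : GL (Fin 2) ℝ) • (OnePoint.infty : OnePoint ℝ) = 𝔞 i)
  (hper : ∀ i, (ConjAct.toConjAct (Matrix.SpecialLinearGroup.toGL (σ i) : GL (Fin 2) ℝ)⁻¹ • Γ).strictPeriods =
    AddSubgroup.zmultiples 1)
  (hineq : ∀ i j, ∀ γ ∈ Γ, γ • 𝔞 i = 𝔞 j → i = j)
  (hcomplete : ∀ c : OnePoint ℝ, IsCusp c Γ → ∃ i, ∃ γ ∈ Γ, γ • 𝔞 i = c)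

/-- `c(σ) = 72(1 - 2·2^{-σ})⁻¹` is continuous on `σ > 1`. [folklore] -/
theorem continuousOn_eisGrowthConst : ContinuousOn eisGrowthConst (Ioi (1 : ℝ)) := by
  unfold eisGrowthConst
  refine continuousOn_const.mul (ContinuousOn.inv₀ ?_ fun σ hσ => ?_)
  · exact continuousOn_const.sub (continuousOn_const.mul
      ((Real.continuous_const_rpow (by norm_num : (2 : ℝ) ≠ 0)).comp continuous_neg).continuousOn)
  · have := two_mul_two_rpow_neg_lt_one (σ := σ) hσ
    linarith

/-- **`c(Re s)` is bounded on compact sets of `{Re s > 1}`.** [folklore] -/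
theorem exists_eisGrowthConst_le {S : Set ℂ} (hS : IsCompact S) (hS1 : S ⊆ {s : ℂ | 1 < s.re}) :
    ∃ c₁ : ℝ, ∀ s ∈ S, eisGrowthConst s.re ≤ c₁ := by
  have hcont : ContinuousOn (fun s : ℂ => eisGrowthConst s.re) S :=
    continuousOn_eisGrowthConst.comp Complex.continuous_re.continuousOn fun s hs => hS1 hs
  obtain ⟨C, hC⟩ := hS.exists_bound_of_continuousOn hcont
  refine ⟨C, fun s hs => ?_⟩
  have := hC s hs
  rw [Real.norm_eq_abs] at this
  exact (le_abs_self _).trans this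

include hΓ hd hper in
/-- **`|φᵢⱼ(s)|` is bounded on compact sets of `{Re s > 1}`.** [folklore] -/
theorem exists_norm_eisScattering_le {S : Set ℂ} (hS : IsCompact S) (hS1 : S ⊆ {s : ℂ | 1 < s.re}) (i j : Fin h) :
    ∃ Φ₁ : ℝ, ∀ s ∈ S, ‖eisScattering Γ σ i j s‖ ≤ Φ₁ := by
  obtain ⟨C, hC⟩ := hS.exists_bound_of_continuousOn ((continuousOn_eisScattering hΓ hd hper i j).mono hS1)
  exact ⟨C, hC⟩

include hΓ hneg hd hF hvol hinfty hper hineq hcomplete in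
/-- **Locally uniform boundedness of `E^Y_𝔞ᵢ(z, s)`**: for a compact set `S` of parameters in
`{Re s > 1}` and `Y ≥ 1` there is `B` with `|E^Y_𝔞ᵢ(z, s)| ≤ B` for all `z ∈ ℍ`, `s ∈ S` — the
proof of `exists_norm_eisTrunc_le` with the joint continuity of `(z, s) ↦ E_𝔞ᵢ(z, s)` on the compact
core and the explicit frame estimates (3.20). [cite: Iwaniec2002, §6.4 (6.29) & (3.20), PDF pp. 46, 88] -/
theorem exists_norm_eisTrunc_le_uniform {S : Set ℂ} (hS : IsCompact S) (hS1 : S ⊆ {s : ℂ | 1 < s.re})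
    (i : Fin h) {Y : ℝ} (hY : 1 ≤ Y) :
    ∃ B : ℝ, ∀ s ∈ S, ∀ z : ℍ, ‖eisTrunc Γ σ i s Y z‖ ≤ B := by
  have ee : ∀ (x : SL(2, ℝ)) (w : ℍ), (Matrix.SpecialLinearGroup.toGL x : GL (Fin 2) ℝ) • w = x • w :=
    fun x w => rfl
  have hY0 : 0 < Y := by linarith
  -- the compact core
  obtain ⟨K, hK, hcov⟩ := exists_compact_of_invHeight_le hΓ hneg hd hF hvol hinfty hper hcomplete Y
  have hTᵢ : Matrix.GeneralLinearGroup.upperRightHom (1 : ℝ) ∈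
      ConjAct.toConjAct (Matrix.SpecialLinearGroup.toGL (σ i) : GL (Fin 2) ℝ)⁻¹ • Γ :=
    upperRightHom_one_mem_of_periods (hper i)
  have hjoint := continuousOn_eisCusp₂ hΓ hd (σ i) hTᵢ
  have hKS : IsCompact (K ×ˢ S) := hK.prod hS
  have hsub : K ×ˢ S ⊆ (Set.univ : Set ℍ) ×ˢ {s : ℂ | 1 < s.re} := prod_mono (subset_univ _) hS1
  obtain ⟨M₁, hM₁⟩ := hKS.exists_bound_of_continuousOn (hjoint.mono hsub)
  -- the frame constants
  obtain ⟨c₁, hc₁⟩ := exists_eisGrowthConst_le hS hS1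
  have hΦ : ∀ j, ∃ Φ₁ : ℝ, ∀ s ∈ S, ‖eisScattering Γ σ i j s‖ ≤ Φ₁ := fun j =>
    exists_norm_eisScattering_le hΓ hd hper hS hS1 i j
  choose Φ hΦ using hΦ
  set Φmax : ℝ := ∑ j, |Φ j| with hΦmax
  have hΦle : ∀ j, ∀ s ∈ S, ‖eisScattering Γ σ i j s‖ ≤ Φmax := by
    intro j s hs
    calc ‖eisScattering Γ σ i j s‖ ≤ Φ j := hΦ j s hs
      _ ≤ |Φ j| := le_abs_self _
      _ ≤ Φmax := by
          rw [hΦmax]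
          exact Finset.single_le_sum (f := fun j => |Φ j|) (fun j _ => abs_nonneg _) (Finset.mem_univ j)
  refine ⟨max M₁ (|c₁| + Φmax), fun s hs z => ?_⟩
  have hs1 : 1 < s.re := hS1 hs
  have haut := isAutomorphic_eisTrunc (σ := σ) hΓ i s Y
  by_cases hle : invHeight Γ σ z ≤ Y
  · rw [eisTrunc_of_invHeight_le hΓ hd hper i s hle]
    obtain ⟨γ, hγ, hγK⟩ := hcov z hle
    have e1 : eisCusp Γ (σ i) z s = eisCusp Γ (σ i) (γ • z) s := (isAutomorphic_eisCusp hΓ (σ i) s γ hγ z).symm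
    rw [e1]
    exact (hM₁ ⟨γ • z, s⟩ ⟨hγK, hs⟩).trans (le_max_left _ _)
  · rw [not_le] at hle
    obtain ⟨γ, hγ, j, u, hu, e⟩ := exists_smul_mem_cuspStrip_of_lt hper hY0.le hle
    have huY : Y < u.im := hu.2.2
    have hu1 : 1 ≤ u.im := by linarith
    rw [← haut γ hγ z, ← e, ee, eisTrunc_frame hΓ hneg hd hinfty hper hineq i j s hY huY]
    set c : ℝ := eisGrowthConst s.re with hc
    have hcle : c ≤ |c₁| := (hc₁ s hs).trans (le_abs_self _)
    have hcpos : 0 < c := eisGrowthConst_pos hs1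
    have hp1 : u.im ^ (-s.re) ≤ 1 := Real.rpow_le_one_of_one_le_of_nonpos hu1 (by linarith)
    have hp2 : u.im ^ (1 - s.re) ≤ 1 := Real.rpow_le_one_of_one_le_of_nonpos hu1 (by linarith)
    have h1 : ‖eisCusp Γ (σ i) (σ j • u) s - (if i = j then ((u.im : ℝ) : ℂ) ^ s else 0)‖ ≤ c := by
      by_cases hij : i = j
      · subst hij
        rw [if_pos rfl]
        refine (norm_eisCusp_frame_sub_cpow_le hΓ hneg hd hper hs1 i u).trans ?_
        rw [← hc]; nlinarith
      · rw [if_neg hij, sub_zero]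
        refine (norm_eisCusp_frame_le_of_ne hΓ hd hinfty hper hineq hs1 hij u).trans ?_
        rw [← hc]; nlinarith
    have h2 : ‖eisScattering Γ σ i j s * ((u.im : ℝ) : ℂ) ^ (1 - s)‖ ≤ Φmax := by
      rw [norm_mul, Complex.norm_cpow_eq_rpow_re_of_pos u.im_pos]
      simp only [Complex.sub_re, Complex.one_re]
      have hφ := hΦle j s hs
      have hΦ0 : 0 ≤ Φmax := (norm_nonneg _).trans hφ
      calc ‖eisScattering Γ σ i j s‖ * u.im ^ (1 - s.re) ≤ Φmax * 1 :=
            mul_le_mul hφ hp2 (by positivity) hΦ0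
        _ = Φmax := mul_one _
    calc ‖eisCusp Γ (σ i) (σ j • u) s -
          ((if i = j then ((u.im : ℝ) : ℂ) ^ s else 0) + eisScattering Γ σ i j s * ((u.im : ℝ) : ℂ) ^ (1 - s))‖
        = ‖(eisCusp Γ (σ i) (σ j • u) s - (if i = j then ((u.im : ℝ) : ℂ) ^ s else 0)) -
            eisScattering Γ σ i j s * ((u.im : ℝ) : ℂ) ^ (1 - s)‖ := by ring_nf
      _ ≤ c + Φmax := (norm_sub_le _ _).trans (add_le_add h1 h2)
      _ ≤ |c₁| + Φmax := by linarith
      _ ≤ max M₁ (|c₁| + Φmax) := le_max_right _ _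

end UniformBound

/-! ## 2. Pointwise holomorphy of `s ↦ E^Y_𝔞ᵢ(z, s)` and the class `[E^Y_𝔞ᵢ(·, s)] ∈ L²(F)` -/

section Analytic

variable (hΓ : Γ ≤ (Matrix.SpecialLinearGroup.toGL : SL(2, ℝ) →* GL (Fin 2) ℝ).range)
  (hneg : (-1 : GL (Fin 2) ℝ) ∈ Γ) (hd : IsDiscreteSubgroup Γ) (hF : IsHypFundamentalDomain Γ F)
  (hvol : volume F < ⊤)
  (hinfty : ∀ i, (Matrix.SpecialLinearGroup.toGL (σ i) : GL (Fin 2) ℝ) • (OnePoint.infty : OnePoint ℝ) = 𝔞 i)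
  (hper : ∀ i, (ConjAct.toConjAct (Matrix.SpecialLinearGroup.toGL (σ i) : GL (Fin 2) ℝ)⁻¹ • Γ).strictPeriods =
    AddSubgroup.zmultiples 1)
  (hineq : ∀ i j, ∀ γ ∈ Γ, γ • 𝔞 i = 𝔞 j → i = j)
  (hcomplete : ∀ c : OnePoint ℝ, IsCusp c Γ → ∃ i, ∃ γ ∈ Γ, γ • 𝔞 i = c)

/-- The open half-plane `{Re s > 1}`. [folklore] -/
theorem isOpen_re_gt_one : IsOpen {s : ℂ | 1 < s.re} := isOpen_lt continuous_const Complex.continuous_re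

include hΓ hneg hd hinfty hper hineq in
/-- **`s ↦ E^Y_𝔞ᵢ(z, s)` is holomorphic in `Re s > 1`** (`E^Y = E - θᵢ^s - Σⱼ φᵢⱼ(s)θⱼ^{1-s}` with
holomorphic pieces, `Y ≥ 1`). [cite: Iwaniec2002, §6.2 & (6.29), PDF pp. 85, 88] -/
theorem differentiableOn_eisTrunc_apply (i : Fin h) {Y : ℝ} (hY : 1 ≤ Y) (z : ℍ) :
    DifferentiableOn ℂ (fun s => eisTrunc Γ σ i s Y z) {s : ℂ | 1 < s.re} := by
  have hY0 : 0 < Y := by linarith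
  have e : ∀ s ∈ {s : ℂ | 1 < s.re}, eisTrunc Γ σ i s Y z = eisCusp Γ (σ i) z s - tailEis Γ σ i s Y z -
      ∑ j, eisScattering Γ σ i j s * tailEis Γ σ j (1 - s) Y z := by
    intro s hs
    have := eisCusp_eq_eisTrunc_add_tails hΓ hd hper i hs hY0 z
    linear_combination -this
  refine DifferentiableOn.congr ?_ e
  refine ((differentiableOn_eisCusp hΓ hd (σ i) (upperRightHom_one_mem_of_periods (hper i)) z).sub
    (differentiable_tailEis_apply hΓ hneg hd hinfty hper hineq i hY z).differentiableOn).sub ?_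
  refine DifferentiableOn.fun_sum fun j _ => ?_
  refine (differentiableOn_eisScattering hΓ hd hper i j).mul ?_
  have h1 : Differentiable ℂ fun s : ℂ => tailEis Γ σ j (1 - s) Y z :=
    (differentiable_tailEis_apply hΓ hneg hd hinfty hper hineq j hY z).comp (differentiable_const _ |>.sub differentiable_id)
  exact h1.differentiableOn

variable (Γ F σ) in
/-- **The class `[E^Y_𝔞ᵢ(·, s)] ∈ L²(F)`** (zero if not square-integrable, which does not happen for
`Re s > 1`, `Y ≥ 1`, finite volume). [cite: Iwaniec2002, (6.29), PDF p. 88] -/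
def eisTruncLp (i : Fin h) (s : ℂ) (Y : ℝ) : Lp ℂ 2 (volume.restrict F) := by
  classical
  exact if hmem : MemLp (eisTrunc Γ σ i s Y) 2 (volume.restrict F) then hmem.toLp _ else 0

/-- The class is represented by `E^Y`. [folklore] -/
theorem eisTruncLp_eq_toLp {i : Fin h} {s : ℂ} {Y : ℝ} (hmem : MemLp (eisTrunc Γ σ i s Y) 2 (volume.restrict F)) :
    eisTruncLp Γ F σ i s Y = hmem.toLp _ := by
  unfold eisTruncLp; rw [dif_pos hmem]

/-- The class is represented by `E^Y`, a.e. form. [folklore] -/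
theorem eisTruncLp_coeFn {i : Fin h} {s : ℂ} {Y : ℝ} (hmem : MemLp (eisTrunc Γ σ i s Y) 2 (volume.restrict F)) :
    (eisTruncLp Γ F σ i s Y : ℍ → ℂ) =ᵐ[volume.restrict F] eisTrunc Γ σ i s Y := by
  rw [eisTruncLp_eq_toLp hmem]; exact MemLp.coeFn_toLp hmem

include hΓ hneg hd hF hvol hinfty hper hineq hcomplete in
/-- **`s ↦ [E^Y_𝔞ᵢ(·, s)] ∈ L²(F)` is holomorphic on `Re s > 1`** (pointwise holomorphy and locally
uniform bounds; `Literature.Analysis.Complex.analyticOnNhd_of_locally_bounded`).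
[cite: Iwaniec2002, §6.2 (6.15) & §6.4, PDF pp. 85, 88] -/
theorem analyticOnNhd_eisTruncLp (i : Fin h) {Y : ℝ} (hY : 1 ≤ Y) :
    AnalyticOnNhd ℂ (fun s => eisTruncLp Γ F σ i s Y) {s : ℂ | 1 < s.re} := by
  haveI : IsFiniteMeasure (volume.restrict F) := isFiniteMeasure_restrict.mpr hvol.ne
  refine Literature.Analysis.Complex.analyticOnNhd_of_locally_bounded (μ := volume.restrict F) isOpen_re_gt_one
    (f := fun s z => eisTrunc Γ σ i s Y z) (fun z => differentiableOn_eisTrunc_apply hΓ hneg hd hinfty hper hineq i hY z)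
    (fun s hs => (measurable_eisTrunc hΓ hd hper hs i (by linarith)).aestronglyMeasurable) ?_ ?_
  · intro s₀ hs₀
    obtain ⟨r, hr, hrU⟩ := Metric.isOpen_iff.mp isOpen_re_gt_one s₀ hs₀
    have hsub : closedBall s₀ (r / 2) ⊆ {s : ℂ | 1 < s.re} :=
      Subset.trans (closedBall_subset_ball (by linarith)) hrU
    obtain ⟨B, hB⟩ := exists_norm_eisTrunc_le_uniform hΓ hneg hd hF hvol hinfty hper hineq hcomplete
      (isCompact_closedBall s₀ (r / 2)) hsub i hY
    exact ⟨closedBall s₀ (r / 2), closedBall_mem_nhds s₀ (by linarith), B, hB⟩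
  · intro s hs
    exact eisTruncLp_coeFn (memLp_eisTrunc hΓ hneg hd hF hvol hinfty hper hineq hcomplete hs i hY)

end Analytic

end Fuchsian

end Literature.NumberTheory.Automorphic
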